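import Mathlib.AlgebraicGeometry.Normalization
import Literature.AlgebraicGeometry.Resolution.FiniteBirationalNormal
import Literature.AlgebraicGeometry.Resolution.BlowupPrincipalCharts
import HarnessLib

/-!
# A morphism with a local section onto a normal scheme is its own Stein factorisation

Topic: `Literature/AlgebraicGeometry/Resolution`. The elementary replacement, in de Jong 1996,
4.12 (p. 68–69: "Let `X' → Y' → ℙ^{d-1}` be the Stein factorization of `f`. Note that
`Y' → ℙ^{d-1}` is (finite) étale […]. We conclude that `Y' = ℙ^{d-1}`"), of the étaleness of
the finite part of the Stein factorisation and the simple connectedness of `ℙ^{d-1}` (SGA 1 XI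
1.1) by the observation that `f` has a LOCAL SECTION (over a standard chart of `ℙ^{d-1}`, through
the exceptional divisor of the blow-up of `ℙ^d` in the vertex, which is a section of the
projection and over which the blown-up `X' = X ×_{ℙ^d} P̃` is split): PROVED here,

* `eq_algebraMap_of_retraction_of_isIntegral` — **algebra**: if `A → B` has a ring retraction
  `r : B → A` (`r ∘ ι = id`) and `B` is a domain, then every element of `B` integral over `A`
  lies in `A`: `b = ι(r(b))` (kill the constant term of a monic relation of `b - ι r b` with `r`
  and divide by `b - ι r b`); so `A ≅` the integral closure of `A` in `B`
  (`algebraMap_integralClosure_bijective_of_retraction`);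
* `isIso_app_fromNormalization_of_section` — for `f : X → Y` quasi-compact quasi-separated with
  `X` integral and a section `σ : U → X` of `f` over an affine open `U` (`σ ≫ f = U ↪ Y`), the
  integral part `Y' = f.normalization → Y` of Mathlib's relative normalization
  (Stacks 035H; = the Stein factorisation target when `f` is proper, Stacks 03H0) is an
  isomorphism on sections over `U` (`Γ(Y', U) =` integral closure of `Γ(Y, U)` in `Γ(X, f⁻¹U)`,
  Mathlib `Scheme.Hom.fromNormalization_app`), hence over `U`;
* **`isIso_fromNormalization_of_section`** — if moreover `Y` is integral and normal and `U` is
  non-empty, `Y' → Y` is an isomorphism: it is integral (Mathlib) and birational (an isomorphism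
  over the dense open `U`), and an integral birational morphism of integral schemes onto a normal
  scheme is an isomorphism (`isIso_of_isIntegralHom_of_isBirational`, `FiniteBirationalNormal.lean`).

Consequently (with Zariski's connectedness theorem in its Stein form, the named fact
`steinFactorization_geometricallyConnected`, Stacks 03H2 (1)) such an `f`, if proper, has
geometrically connected fibres (`steinFactorization_geometricallyConnected.of_isIso_fromNormalization`).
No named facts; [folklore] throughout.

## Sources

* A. J. de Jong, *Smoothness, semi-stability and alterations*, Publ. Math. IHÉS 83 (1996), 4.12,
  pp. 68–69. [DeJong1996]
* The Stacks Project, Tags 035H, 03H0, 03H2, 0AB1. [StacksProject]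
-/

noncomputable section

open CategoryTheory CategoryTheory.Limits AlgebraicGeometry TopologicalSpace Polynomial

namespace Literature.AlgebraicGeometry.Resolution

universe u

/-! ## Algebra: integral elements in the presence of a retraction -/

section Algebra

variable {A B : Type*} [CommRing A] [CommRing B] [IsDomain B] [Algebra A B] (r : B →ₐ[A] A)

omit r in
/-- `A` is non-trivial (it maps to the domain `B`). [folklore] -/
theorem nontrivial_of_algebra_isDomain (A B : Type*) [CommRing A] [CommRing B] [IsDomain B] [Algebra A B] :
    Nontrivial A :=
  (algebraMap A B).domain_nontrivial

/-- If `r : B → A` is an `A`-retraction and `B` is a domain, an element of `B` killed by `r` and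
by a monic polynomial over `A` vanishes (induction on the degree: `r` kills the constant term,
then divide by the element). [folklore] -/
theorem eq_zero_of_retraction_of_aeval_eq_zero (n : ℕ) :
    ∀ (p : A[X]), p.Monic → p.natDegree = n → ∀ x : B, aeval x p = 0 → r x = 0 → x = 0 := by
  haveI := nontrivial_of_algebra_isDomain A B
  induction n with
  | zero =>
    intro p hp hn x hpx _
    rw [hp.natDegree_eq_zero] at hn
    rw [hn, map_one] at hpx
    exact (one_ne_zero hpx).elim
  | succ n ih =>
    intro p hp hn x hpx hrx
    -- the constant term of `p` vanishes: apply `r` to `p(x) = 0`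
    have h0 : p.coeff 0 = 0 := by
      have key := congrArg r hpx
      rw [← X_mul_divX_add p, map_add, map_mul, aeval_X, aeval_C, map_zero, map_add, map_mul,
        hrx, zero_mul, zero_add, AlgHom.commutes, Algebra.algebraMap_self, RingHom.id_apply] at key
      exact key
    -- so `p = X * q` with `q` monic of degree `n`, and `x * q(x) = 0`
    obtain ⟨q, hq⟩ := X_dvd_iff.mpr h0
    have hqm : q.Monic := Monic.of_mul_monic_left monic_X (hq ▸ hp)
    have hqn : q.natDegree = n := by
      rw [hq, natDegree_X_mul hqm.ne_zero] at hn
      exact Nat.succ_injective hn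
    rw [hq, map_mul, aeval_X] at hpx
    rcases mul_eq_zero.mp hpx with h | h
    · exact h
    · exact ih q hqm hqn x h hrx

/-- **An element integral over `A` lies in `A`** when `A → B` has an `A`-retraction and `B` is
a domain: `x = ι(r(x))`. [folklore] -/
theorem eq_algebraMap_of_retraction_of_isIntegral {x : B} (hx : IsIntegral A x) :
    x = algebraMap A B (r x) := by
  have hy : IsIntegral A (x - algebraMap A B (r x)) := hx.sub isIntegral_algebraMap
  obtain ⟨p, hp, hpy⟩ := hy
  have h := eq_zero_of_retraction_of_aeval_eq_zero r p.natDegree p hp rfl _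
    (by rwa [aeval_def]) (by rw [map_sub, AlgHom.commutes, Algebra.algebraMap_self, RingHom.id_apply, sub_self])
  exact sub_eq_zero.mp h

include r in
/-- **`A ≅` the integral closure of `A` in `B`** when `A → B` has an `A`-retraction and `B` is a
domain. [folklore] -/
theorem algebraMap_integralClosure_bijective_of_retraction :
    Function.Bijective (algebraMap A (integralClosure A B)) := by
  constructor
  · intro a b h
    have h' := congrArg (fun c : integralClosure A B => r (c : B)) h
    simpa only [Subalgebra.coe_algebraMap, AlgHom.commutes, Algebra.algebraMap_self,
      RingHom.id_apply] using h'
  · intro c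
    refine ⟨r (c : B), Subtype.ext ?_⟩
    rw [Subalgebra.coe_algebraMap]
    exact (eq_algebraMap_of_retraction_of_isIntegral r c.2).symm

end Algebra

/-! ## The retraction on sections defined by a local section of `f` -/

section Scheme

variable {X Y : Scheme.{u}} (f : X ⟶ Y)

/-- A section `σ` of `f` over `U` maps `U` into `f⁻¹(U)`. [folklore] -/
theorem top_le_preimage_preimage_of_section {U : Y.Opens} (σ : (U : Scheme.{u}) ⟶ X)
    (hσ : σ ≫ f = U.ι) : ⊤ ≤ σ ⁻¹ᵁ (f ⁻¹ᵁ U) := by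
  rw [← Scheme.Hom.comp_preimage, hσ, Scheme.Opens.ι_preimage_self]

/-- Restriction maps of a presheaf around a loop `U ⟶ V ⟶ U` compose to the identity.
[folklore] -/
theorem presheaf_map_map_apply {Z : Scheme.{u}} {U V : Z.Opens} (i : Opposite.op U ⟶ Opposite.op V)
    (j : Opposite.op V ⟶ Opposite.op U) (a : Γ(Z, U)) : Z.presheaf.map j (Z.presheaf.map i a) = a := by
  rw [← CommRingCat.comp_apply, ← Z.presheaf.map_comp, Subsingleton.elim (i ≫ j) (𝟙 _), Z.presheaf.map_id]
  rfl

/-- **The retraction `σ^* : Γ(X, f⁻¹U) → Γ(U, 𝒪_U) = Γ(Y, U)` defined by a section `σ` of `f`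
over `U`.** [folklore] -/
def sectionRetraction {U : Y.Opens} (σ : (U : Scheme.{u}) ⟶ X) (hσ : σ ≫ f = U.ι) :
    Γ(X, f ⁻¹ᵁ U) →+* Γ(Y, U) :=
  (σ.appLE (f ⁻¹ᵁ U) ⊤ (top_le_preimage_preimage_of_section f σ hσ) ≫ U.topIso.hom).hom

/-- `σ^* ∘ f^* = id` on `Γ(Y, U)`. [folklore] -/
theorem sectionRetraction_app {U : Y.Opens} (σ : (U : Scheme.{u}) ⟶ X) (hσ : σ ≫ f = U.ι)
    (a : Γ(Y, U)) : sectionRetraction f σ hσ (f.app U a) = a := by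
  rw [sectionRetraction, ← CommRingCat.comp_apply, ← Category.assoc, ← Scheme.Hom.comp_appLE,
    appLE_congr_hom hσ, Scheme.Opens.ι_appLE, Scheme.Opens.topIso_hom, CommRingCat.comp_apply]
  exact presheaf_map_map_apply _ _ a

variable [QuasiCompact f] [QuasiSeparated f]

/-- **Over an affine open carrying a section of `f`, `Y' = f.normalization → Y` is an
isomorphism on sections**: `Γ(Y', U) =` the integral closure of `Γ(Y, U)` in the domain
`Γ(X, f⁻¹U)` (Mathlib), which is `Γ(Y, U)` itself thanks to the retraction `σ^*`.
[folklore] -/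
theorem isIso_app_fromNormalization_of_section [IsIntegral X] {U : Y.Opens} (hU : IsAffineOpen U)
    [Nonempty U] (σ : (U : Scheme.{u}) ⟶ X) (hσ : σ ≫ f = U.ι) :
    IsIso (f.fromNormalization.app U) := by
  letI := (f.app U).hom.toAlgebra
  -- `f⁻¹ U` is non-empty (it contains `σ(u)`), so its sections form a domain
  obtain ⟨u⟩ := (inferInstance : Nonempty U)
  haveI : Nonempty (f ⁻¹ᵁ U) := ⟨⟨σ u, top_le_preimage_preimage_of_section f σ hσ (Set.mem_univ u)⟩⟩
  haveI : IsDomain Γ(X, f ⁻¹ᵁ U) := IsIntegral.component_integral _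
  let r : Γ(X, f ⁻¹ᵁ U) →ₐ[Γ(Y, U)] Γ(Y, U) :=
    { toRingHom := sectionRetraction f σ hσ
      commutes' := sectionRetraction_app f σ hσ }
  have hbij := algebraMap_integralClosure_bijective_of_retraction r
  have hiso : IsIso (CommRingCat.ofHom (algebraMap Γ(Y, U) (integralClosure Γ(Y, U) Γ(X, f ⁻¹ᵁ U)))) :=
    (RingEquiv.ofBijective (algebraMap Γ(Y, U) (integralClosure Γ(Y, U) Γ(X, f ⁻¹ᵁ U))) hbij).toCommRingCatIso.isIso_hom
  rw [f.fromNormalization_app hU]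
  infer_instance

/-- … hence `Y' → Y` is an isomorphism over `U`. [folklore] -/
theorem isIso_morphismRestrict_fromNormalization_of_section [IsIntegral X] {U : Y.Opens}
    (hU : IsAffineOpen U) [Nonempty U] (σ : (U : Scheme.{u}) ⟶ X) (hσ : σ ≫ f = U.ι) :
    IsIso (f.fromNormalization ∣_ U) := by
  haveI := isIso_app_fromNormalization_of_section f hU σ hσ
  exact isIso_morphismRestrict_of_isIso_app _ hU

/-- **A morphism from an integral scheme to a normal integral scheme with a local section is
its own Stein factorisation**: `Y' = f.normalization → Y` is an isomorphism (integral — Mathlib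
— and birational, being an isomorphism over the dense open `U`; then
`isIso_of_isIntegralHom_of_isBirational`). In de Jong 1996, 4.12 this replaces "`Y' → ℙ^{d-1}`
is finite étale and `ℙ^{d-1}` is simply connected". [cite: DeJong1996, 4.12, pp. 68–69] -/
theorem isIso_fromNormalization_of_section [IsIntegral X] [IsIntegral Y]
    (hY : ∀ y : Y, IsIntegrallyClosed (Y.presheaf.stalk y)) {U : Y.Opens} (hU : IsAffineOpen U)
    [Nonempty U] (σ : (U : Scheme.{u}) ⟶ X) (hσ : σ ≫ f = U.ι) : IsIso f.fromNormalization := by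
  haveI := isIso_morphismRestrict_fromNormalization_of_section f hU σ hσ
  obtain ⟨u⟩ := (inferInstance : Nonempty U)
  refine isIso_of_isIntegralHom_of_isBirational f.fromNormalization hY ⟨U, ?_, ?_, this⟩
  · exact U.2.dense ⟨u.1, u.2⟩
  · refine (f.fromNormalization ⁻¹ᵁ U).2.dense ⟨f.toNormalization (σ u), ?_⟩
    change f.fromNormalization (f.toNormalization (σ u)) ∈ U
    rw [← Scheme.Hom.comp_apply, Scheme.Hom.toNormalization_fromNormalization, ← Scheme.Hom.comp_apply, hσ]
    exact u.2

end Scheme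

end Literature.AlgebraicGeometry.Resolution

end
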